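import Summits.QuantumFields.YangMills.Theorems.PencilRigidityNPointIsotropyMopupHelpers
import Summits.QuantumFields.YangMills.Theorems.NPointIsotropy.Negative.DegreeTwoFree
import Literature.MathematicalPhysics.AQFT.StandardSubspace
import Literature.MathematicalPhysics.AQFT.ModularData
import Literature.MathematicalPhysics.QuantumFieldTheory.OSTimeContinuation
import HarnessLib.Audit

/-!
# Line `one-field-cocycle-pinning` — checked skeleton for crux `MirrorModularBoosts.CurvatureBoostCovariance`
(stmt-QuantumFields-9663; crux-plan, round 1; planner-cruxplan-stmt-QuantumFields-9663-one-field-cocycle-pi-0)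

Idea (card `Ideas/one-field-cocycle-pinning.md`, triage r1-1/2/3: pass): all non-geometric freedom of the wedge
modular group of the curvature channel, SEEN FROM THE ONE-FIELD SPACE, is a scalar cocycle; two-point planar isotropy
(S2) makes the geometric boosts unitary there, and then ONE pinned matrix element — the modular CONJUGATION of the wedge
standard subspace acting as the wedge reflection on one-field wedge vectors, (P_J) — forces `Δ_K^{it}` to act
geometrically on one-field vectors; the separating vacuum lifts this to all fields, i.e. to boost-invariant Wightman
functions, which continue back to planar-rotation-invariant Schwinger functions.  (P_J) is an exact identity at every
lattice spacing (reflection-positive Schmidt decomposition); its survival in the continuum is THE BET (`stub_continuumPinning`).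

Shape.  The crux is `∀ G …, W1 r sch S₁ → EightFrameRP S₁ → PlanarCone S₁ → PlanarInvariant S₁`
(`Negative.Unbundled.crux_iff`).  The modular middle cannot be stated Euclidean-ly (upper-half-plane one-point vectors
are never in `D(Δ^{1/2})`; without rotation invariance `Δ_K` has no Euclidean description), so it is stated in a
REAL-TIME PACKAGE posited through existing tree vocabulary — Wightman data `W : WightmanData 3 Unit` without Lorentz
covariance (`NoLorentzWightman`: planar spectral condition `H ≥ |P₁|`, wedge locality), the time-Wick-rotation link
`IsTimeWickRotationOf W S₁` (tree `timeTube` / `HasTimeRayBoundaryValue` / `IsWightmanDistributionOf`), the wedge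
standard subspace `K : StandardSubspace W.H` (Mathlib; = closure of the symmetrised real wedge polynomial vectors,
`IsWedgeStandardSubspace`) with its modular data `D : StandardSubspace.ModularData K` (tree; exist and are unique),
and the wedge von Neumann algebra `M` in standard form (`WedgeAlgebraLink`) — whose EXISTENCE is one stub
(`stub_wedgeReconstruction`, the route's foreseen child AxisWedgeStandardness) and over which the other stubs quantify.

Front end (S2), BY NAME from route PencilRigidity (triage r1-2 §G2 "import, do not rebuild"): the composition takes
`CurvatureKernelBound` (stmt-11687, the YM UV datum), `KernelTransfer` (stmt-11688) and `ShellRigidity` (stmt-11685) as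
hypotheses — registered route items — and derives the radial two-point kernel, hence planar invariance of `S₁ 2`
(landed `radialKernel_invariant_two`).  Junk-proofing (triage r1-2 §G1): the tie is consumed by `stub_tieRegularity`
(every `𝔖ₙ|⁰𝒮` a function) and the last step is the LANDED mop-up `planarInvariant_of_regular`.

Stubs (6): A `stub_tieRegularity` · C `stub_wedgeReconstruction` · D `stub_continuumPinning` (THE BET, hardest) ·
E `stub_oneFieldRigidity` (the lever) · F `stub_separatingLift` · G `stub_euclideanReturn`.
Composition `CurvatureBoostCovariance_of` is sorry-free; sorries live only in `stub_*`.  The Appendix (before the line's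
namespace) is a verbatim copy of the landed mop-up `Theorems/PencilRigidityNPointIsotropyMopup.lean` part 2, inlined only
because the farm had not built that module at check time — LEAD: replace it by the import.

VOCABULARY NOTE for the lead: stubs C–G are stated over the line-local §0 vocabulary (`NoLorentzWightman`,
`IsTimeWickRotationOf`, `realWedgeSpan`, `IsWedgeStandardSubspace`, `WedgeAlgebraLink`, `JPinned`, `OneFieldGeometric`,
`BoostInvariantWightman`, `TwoPointPlanarInvariant`, with `onePt`, `polyVec`, `boostTest`, `wedgeReflTest`, `wedgeRefl`,
`RightWedge`, `LeftWedge`, `IsRealTest`), all sorry-free definitions over tree/Mathlib declarations.  Since stub workers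
cannot import `Cruxes/…/Lines/*.lean`, land §0 first as a definitions-only support file (e.g.
`Theorems/CurvatureBoostCovariance/OneFieldVocabulary.lean`, `--supports stmt-QuantumFields-9663`) and re-register the
stubs over it (or unfold, as NPointIsotropy's generation 3 did); the statements do not change.

Disproof used: `curvatureBoostCovariance_false_without_hconv` (model-blind core false) — the tie enters at A and D and
through `CurvatureKernelBound`; `not_curvatureBoostCovarianceOnAllTests` — every statement reads `S₁` on `⁰𝒮` or on
time-ordered tests only; `NPointIsotropy.Negative.ModelBlindFalse`/`PlanarGenericJunk` — A + landed mop-up;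
`QuarterTurnPositiveFalse` — no Euclidean quarter-turn form on `e₀`-ordered supports is used ((P_J), real time);
Disproof §3/§4 vacuity: for the vacuum family `K = ℝΩ` and every stub holds trivially, none is false.
-/

noncomputable section

-- Mathlib's `SimplexCategory` instance `Fintype (Fin (x.len + 1))` matches `Fintype (Fin 4)` and makes concrete `Fin 4`
-- instance paths diverge between elaborations (tree-known file-local workaround, as in the landed `Negative/*.lean`).
attribute [-instance] SimplexCategory.instFintypeToTypeOrderHomFinHAddNatLenOfNat

/-! ## Appendix — the mop-up to all of `⁰𝒮`: VERBATIM COPY of the landed, sorry-free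
`Theorems/PencilRigidityNPointIsotropyMopup.lean` (part 2: `Mopup.exists_generic_set`, `Mopup.exists_smooth_exhaustion`,
`Mopup.apply_linActMulti_eq_of_generic`, `planarInvariant_of_regular`), in its ORIGINAL namespace, inlined here ONLY
because the Lean farm had not yet built that module when this skeleton was checked (`remote:stale:…:unbuilt`).
LEAD: delete this appendix and `import Summits.QuantumFields.YangMills.Theorems.PencilRigidityNPointIsotropyMopup`
once the farm serves it (the composition below calls `ComplexRotationBandlimit.planarInvariant_of_regular` either way).
Nothing in this appendix is this line's work or a stub. -/

namespace Summit.QuantumFields.YangMills.Theorems.NPointIsotropy.ComplexRotationBandlimit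

open scoped BigOperators SchwartzMap InnerProductSpace Topology ENNReal
open MeasureTheory Filter
open Literature.MathematicalPhysics.QuantumLattice Literature.MathematicalPhysics.AQFT
  Literature.MathematicalPhysics.QuantumFieldTheory
open Summit.QuantumFields.YangMills.Theorems.NPointIsotropy.Negative (E4)
open Summit.QuantumFields.YangMills.Theorems.CurvatureBoostCovariance.Negative
  (PlanarInvariant isOffDiagonal_linActMulti)

namespace Mopup

variable {n : ℕ}

/-! ## The algebraic generic set (open, conull, off the coincidence locus, planar-generic) -/

/-- Coordinates `0` and `1` of the plane rotation `planeRot 0 φ` on `ℝ⁴`. [folklore] -/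
theorem planeRot_zero_one (φ : ℝ) (y : E4) :
    (planeRot (d := 3) 0 φ y) 0 = Real.cos φ * y 0 + Real.sin φ * y 1 ∧
      (planeRot (d := 3) 0 φ y) 1 = -Real.sin φ * y 0 + Real.cos φ * y 1 := by
  refine ⟨by simp [planeRot_apply], ?_⟩
  rw [planeRot_apply]
  simp [Fin.succ_zero_eq_one]

/-- **The algebraic generic set.** There is an open CONULL set `G` of `n`-point configurations, avoiding the
coincidence locus, on which for EVERY angle `φ` the rotated configuration has pairwise distinct `x₀`-coordinates or
pairwise distinct `x₁`-coordinates: `G = {x | ⟨π(xᵢ-xⱼ), π(x_k-x_l)⟩ ≠ 0 for all i ≠ j, k ≠ l}` (all planar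
differences non-zero and pairwise non-orthogonal; its complement is a finite union of null quadrics,
`volume_pairing_eq_zero`). [folklore] -/
theorem exists_generic_set (n : ℕ) :
    ∃ G : Set (Fin n → E4), IsOpen G ∧ volume Gᶜ = 0 ∧ G ⊆ (coincidenceLocus n E4)ᶜ ∧
      ∀ x ∈ G, ∀ φ : ℝ,
        (∀ i j : Fin n, i ≠ j → (planeRot (d := 3) 0 φ (x i)) 0 ≠ (planeRot (d := 3) 0 φ (x j)) 0) ∨
        (∀ i j : Fin n, i ≠ j → (planeRot (d := 3) 0 φ (x i)) 1 ≠ (planeRot (d := 3) 0 φ (x j)) 1) := by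
  -- the pairing and the generic set
  set P : Fin n → Fin n → Fin n → Fin n → (Fin n → E4) → ℝ := fun i j k l x =>
    (x i 0 - x j 0) * (x k 0 - x l 0) + (x i 1 - x j 1) * (x k 1 - x l 1) with hP
  set G : Set (Fin n → E4) := ⋂ i, ⋂ j, ⋂ k, ⋂ l, {x | i ≠ j → k ≠ l → P i j k l x ≠ 0} with hG
  have hmem : ∀ x, x ∈ G ↔ ∀ i j k l : Fin n, i ≠ j → k ≠ l → P i j k l x ≠ 0 := fun x => by
    simp only [hG, Set.mem_iInter, Set.mem_setOf_eq]
  have hPc : ∀ i j k l, Continuous (P i j k l) := fun i j k l => continuous_pairing i j k l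
  -- each defining condition cuts out an open conull set
  have hfac : ∀ i j k l : Fin n, IsOpen {x : Fin n → E4 | i ≠ j → k ≠ l → P i j k l x ≠ 0} ∧
      volume {x : Fin n → E4 | i ≠ j → k ≠ l → P i j k l x ≠ 0}ᶜ = 0 := by
    intro i j k l
    by_cases hij : i = j
    · simp [hij]
    by_cases hkl : k = l
    · simp [hkl]
    have hset : {x : Fin n → E4 | i ≠ j → k ≠ l → P i j k l x ≠ 0} = {x | P i j k l x ≠ 0} := by
      ext x; simp [hij, hkl]
    rw [hset]
    refine ⟨isOpen_ne_fun (hPc i j k l) continuous_const, ?_⟩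
    have hc : {x : Fin n → E4 | P i j k l x ≠ 0}ᶜ = {x | P i j k l x = 0} := by
      ext x; simp
    rw [hc]
    exact volume_pairing_eq_zero i j k l hij hkl
  refine ⟨G, ?_, ?_, ?_, ?_⟩
  · exact isOpen_iInter_of_finite fun i => isOpen_iInter_of_finite fun j =>
      isOpen_iInter_of_finite fun k => isOpen_iInter_of_finite fun l => (hfac i j k l).1
  · simp only [hG, Set.compl_iInter]
    exact measure_iUnion_null fun i => measure_iUnion_null fun j =>
      measure_iUnion_null fun k => measure_iUnion_null fun l => (hfac i j k l).2
  · -- off the coincidence locus: `P i j i j x = |π(xᵢ - xⱼ)|² ≠ 0`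
    rintro x hx ⟨i, j, hij, hxij⟩
    have h := (hmem x).1 hx i j i j hij hij
    simp [hP, hxij] at h
  · -- genericity at every angle
    intro x hx φ
    by_contra hcon
    simp only [not_or, not_forall, not_not, exists_prop] at hcon
    obtain ⟨⟨i, j, hij, h0⟩, ⟨k, l, hkl, h1⟩⟩ := hcon
    rw [(planeRot_zero_one φ (x i)).1, (planeRot_zero_one φ (x j)).1] at h0
    rw [(planeRot_zero_one φ (x k)).2, (planeRot_zero_one φ (x l)).2] at h1
    have hcs := Real.cos_sq_add_sin_sq φ
    refine (hmem x).1 hx i j k l hij hkl ?_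
    simp only [hP]
    linear_combination (Real.cos φ * (x k 0 - x l 0) + Real.sin φ * (x k 1 - x l 1)) * h0 +
      (-Real.sin φ * (x i 0 - x j 0) + Real.cos φ * (x i 1 - x j 1)) * h1 -
      ((x i 0 - x j 0) * (x k 0 - x l 0) + (x i 1 - x j 1) * (x k 1 - x l 1)) * hcs

/-! ## The a.e. mop-up: truncation, dominated convergence -/

/-- **Smooth compactly supported exhaustion of an open set** of a finite-dimensional real normed space: smooth
`χ_k : X → [0,1]` with compact support inside `G`, eventually `1` at every point of `G` and `0` off `G`
(from a smooth function with support exactly `G`, `IsOpen.exists_contDiff_support_eq`, cut off by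
`Real.smoothTransition` and a bump of large radius). [folklore] -/
theorem exists_smooth_exhaustion {X : Type*} [NormedAddCommGroup X] [NormedSpace ℝ X]
    [FiniteDimensional ℝ X] {G : Set X} (hG : IsOpen G) :
    ∃ χ : ℕ → X → ℝ, (∀ k, ContDiff ℝ (⊤ : ℕ∞) (χ k)) ∧ (∀ k, HasCompactSupport (χ k)) ∧
      (∀ k, tsupport (χ k) ⊆ G) ∧ (∀ k x, 0 ≤ χ k x ∧ χ k x ≤ 1) ∧
      (∀ x ∈ G, ∀ᶠ k in atTop, χ k x = 1) ∧ (∀ x ∉ G, ∀ k, χ k x = 0) := by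
  obtain ⟨f, hfsupp, hfsmooth, hfrange⟩ := hG.exists_contDiff_support_eq (n := ⊤)
  have hf0 : ∀ x, 0 ≤ f x := fun x => (hfrange ⟨x, rfl⟩).1
  let b : ℕ → ContDiffBump (0 : X) := fun k => ⟨k + 1, k + 2, by positivity, by linarith⟩
  refine ⟨fun k x => Real.smoothTransition (((k : ℝ) + 2) * f x - 1) * b k x, fun k => ?_,
    fun k => ?_, fun k => ?_, fun k x => ?_, fun x hx => ?_, fun x hx k => ?_⟩
  · exact (Real.smoothTransition.contDiff.comp
      ((contDiff_const.mul hfsmooth).sub contDiff_const)).mul (b k).contDiff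
  · exact (b k).hasCompactSupport.mul_left
  · refine tsupport_mul_subset_left.trans ?_
    have hclosed : IsClosed {x : X | ((k : ℝ) + 2)⁻¹ ≤ f x} :=
      isClosed_le continuous_const hfsmooth.continuous
    refine (closure_minimal (fun x hx => ?_) hclosed).trans fun x hx => ?_
    · rw [Function.mem_support] at hx
      have hpos : 0 < ((k : ℝ) + 2) * f x - 1 := by
        by_contra hle
        exact hx (Real.smoothTransition.zero_of_nonpos (not_lt.1 hle))
      show ((k : ℝ) + 2)⁻¹ ≤ f x
      rw [inv_le_iff_one_le_mul₀ (by positivity)]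
      linarith
    · have hfx : f x ≠ 0 := by
        intro h0
        have h : ((k : ℝ) + 2)⁻¹ ≤ 0 := by simpa [h0] using hx
        exact absurd h (not_le.2 (by positivity))
      rw [← hfsupp]
      exact Function.mem_support.2 hfx
  · exact ⟨mul_nonneg (Real.smoothTransition.nonneg _) (b k).nonneg,
      mul_le_one₀ (Real.smoothTransition.le_one _) (b k).nonneg (b k).le_one⟩
  · have hfx : 0 < f x := by
      have hne : f x ≠ 0 := by rw [← Function.mem_support, hfsupp]; exact hx
      exact lt_of_le_of_ne (hf0 x) (Ne.symm hne)
    have h1 : ∀ᶠ k : ℕ in atTop, 2 / f x ≤ (k : ℝ) + 2 :=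
      eventually_atTop.2 ⟨⌈2 / f x⌉₊, fun k hk =>
        ((Nat.le_ceil _).trans (Nat.cast_le.2 hk)).trans (by linarith)⟩
    have h2 : ∀ᶠ k : ℕ in atTop, ‖x‖ ≤ (k : ℝ) + 1 :=
      eventually_atTop.2 ⟨⌈‖x‖⌉₊, fun k hk =>
        ((Nat.le_ceil _).trans (Nat.cast_le.2 hk)).trans (by linarith)⟩
    filter_upwards [h1, h2] with k hk1 hk2
    have hsT : Real.smoothTransition (((k : ℝ) + 2) * f x - 1) = 1 := by
      apply Real.smoothTransition.one_of_one_le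
      have h : 2 ≤ ((k : ℝ) + 2) * f x := by
        rw [div_le_iff₀ hfx] at hk1
        linarith
      linarith
    have hb : b k x = 1 := (b k).one_of_mem_closedBall (by simpa using hk2)
    simp [hsT, hb]
  · have hfx : f x = 0 := by
      by_contra hne
      exact hx (hfsupp ▸ Function.mem_support.2 hne)
    simp [hfx, Real.smoothTransition.zero_of_nonpos]

/-- **Regular + invariant on generic compact supports ⇒ invariant on `⁰𝒮ₙ` (a.e. form).** Let `T` be a
degree-`n` functional that on `⁰𝒮ₙ` is integration against a FUNCTION `W` (`W·F` integrable), `L` a linear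
isometry of `ℝ⁴`, and `G` an open conull set of configurations avoiding the coincidence locus such that
`T (L·F) = T F` for every compactly supported test function `F` supported in `G`. Then `T (L·F) = T F` for every
`F ∈ ⁰𝒮ₙ`. Proof: `T (L·F) - T F = ∫ (W ∘ L - W)·F` (invariance of Lebesgue measure); for `F ∈ ⁰𝒮ₙ` the
compactly supported truncations `χ_k F` (`exists_smooth_exhaustion`) are supported in `G`, so
`∫ (W ∘ L - W)·χ_k F = 0`, and dominated convergence (`|χ_k| ≤ 1`, `χ_k → 1_G`, `Gᶜ` null) gives
`∫ (W ∘ L - W)·F = 0`. [folklore] -/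
theorem apply_linActMulti_eq_of_generic (T : 𝓢((Fin n → E4), ℂ) →L[ℂ] ℂ) {W : (Fin n → E4) → ℂ}
    (hrep : ∀ F : 𝓢((Fin n → E4), ℂ), IsOffDiagonal F →
      Integrable (fun x => W x * F x) ∧ T F = ∫ x, W x * F x)
    (L : E4 ≃ₗᵢ[ℝ] E4) {G : Set (Fin n → E4)} (hGo : IsOpen G) (hG0 : volume Gᶜ = 0)
    (hGc : G ⊆ (coincidenceLocus n E4)ᶜ)
    (hinv : ∀ F : 𝓢((Fin n → E4), ℂ), tsupport (F : (Fin n → E4) → ℂ) ⊆ G →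
      HasCompactSupport (F : (Fin n → E4) → ℂ) → T (linActMulti L F) = T F)
    (F : 𝓢((Fin n → E4), ℂ)) (hF : IsOffDiagonal F) : T (linActMulti L F) = T F := by
  set ρ : (Fin n → E4) → (Fin n → E4) := fun x k => L (x k) with hρ
  -- `T (L·F') = ∫ (W ∘ ρ) F'` with an integrable integrand, for every off-diagonal `F'`
  have hint : ∀ F' : 𝓢((Fin n → E4), ℂ), IsOffDiagonal F' →
      Integrable (fun x => W (ρ x) * F' x) ∧ T (linActMulti L F') = ∫ x, W (ρ x) * F' x := by
    intro F' hF'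
    obtain ⟨h1, h2⟩ := hrep _ (isOffDiagonal_linActMulti hF' L)
    have hcomp : (fun x => W (ρ x) * F' x) = (fun y => W y * linActMulti L F' y) ∘ ρ := by
      funext x
      simp [hρ, linActMulti_apply]
    refine ⟨?_, ?_⟩
    · rw [hcomp]
      exact (measurePreserving_diag L).integrable_comp_of_integrable h1
    · rw [h2]
      exact (integral_mul_linActMulti L W F').symm
  -- the defect `D = W ∘ ρ - W` integrates to `T (L·F') - T F'` against off-diagonal `F'`
  set D : (Fin n → E4) → ℂ := fun x => W (ρ x) - W x with hD
  have hDint : ∀ F' : 𝓢((Fin n → E4), ℂ), IsOffDiagonal F' →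
      Integrable (fun x => D x * F' x) ∧ ∫ x, D x * F' x = T (linActMulti L F') - T F' := by
    intro F' hF'
    have hA := hint F' hF'
    have hB := hrep F' hF'
    have hfun : (fun x => D x * F' x) = fun x => W (ρ x) * F' x - W x * F' x := by
      funext x; simp only [hD]; ring
    rw [hfun]
    exact ⟨hA.1.sub hB.1, by rw [integral_sub hA.1 hB.1, hA.2, hB.2]⟩
  -- truncations of `F` supported in `G`
  obtain ⟨χ, hχs, hχc, hχG, hχ01, hχ1, hχ0⟩ := exists_smooth_exhaustion hGo
  have hcs : ∀ k, HasCompactSupport fun x : Fin n → E4 => (χ k x : ℂ) * F x := fun k =>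
    ((hχc k).comp_left Complex.ofReal_zero).mul_right
  have hsm : ∀ k, ContDiff ℝ (⊤ : ℕ∞) fun x : Fin n → E4 => (χ k x : ℂ) * F x := fun k =>
    (Complex.ofRealCLM.contDiff.comp (hχs k)).mul (F.smooth _)
  set Fk : ℕ → 𝓢((Fin n → E4), ℂ) := fun k => (hcs k).toSchwartzMap (hsm k) with hFk
  have hFk_apply : ∀ k x, Fk k x = (χ k x : ℂ) * F x := fun k x => rfl
  have hFk_supp : ∀ k, tsupport (Fk k : (Fin n → E4) → ℂ) ⊆ G := fun k =>
    (tsupport_mul_subset_left (f := fun x => (χ k x : ℂ)) (g := (F : (Fin n → E4) → ℂ))).trans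
      ((tsupport_comp_subset Complex.ofReal_zero (χ k)).trans (hχG k))
  have hFk_off : ∀ k, IsOffDiagonal (Fk k) := fun k =>
    IsOffDiagonal.of_tsupport_subset ((hFk_supp k).trans hGc)
  have hzero : ∀ k, ∫ x, D x * Fk k x = 0 := fun k => by
    rw [(hDint _ (hFk_off k)).2, hinv _ (hFk_supp k) (hcs k), sub_self]
  -- dominated convergence: `∫ D·χ_k F → ∫ 1_G D·F = ∫ D·F`
  have hDF := hDint F hF
  have hlim : Tendsto (fun k => ∫ x, D x * Fk k x) atTop
      (𝓝 (∫ x, G.indicator (fun x => D x * F x) x)) := by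
    refine tendsto_integral_of_dominated_convergence (fun x => ‖D x * F x‖)
      (fun k => (hDint _ (hFk_off k)).1.aestronglyMeasurable) hDF.1.norm (fun k => ?_) ?_
    · refine Eventually.of_forall fun x => ?_
      rw [hFk_apply, norm_mul, norm_mul, norm_mul, Complex.norm_real,
        Real.norm_of_nonneg (hχ01 k x).1]
      exact mul_le_mul_of_nonneg_left (mul_le_of_le_one_left (norm_nonneg _) (hχ01 k x).2)
        (norm_nonneg _)
    · refine Eventually.of_forall fun x => ?_
      by_cases hx : x ∈ G
      · rw [Set.indicator_of_mem hx]
        refine tendsto_const_nhds.congr' ((hχ1 x hx).mono fun k hk => ?_)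
        show D x * F x = D x * Fk k x
        rw [hFk_apply, hk, Complex.ofReal_one, one_mul]
      · rw [Set.indicator_of_notMem hx]
        have h : (fun k => D x * Fk k x) = fun _ => 0 := by
          funext k; rw [hFk_apply, hχ0 x hx k, Complex.ofReal_zero, zero_mul, mul_zero]
        rw [h]
        exact tendsto_const_nhds
  have hGind : ∫ x, G.indicator (fun x => D x * F x) x = ∫ x, D x * F x :=
    integral_congr_ae (Filter.eventuallyEq_of_mem (mem_ae_iff.2 hG0)
      fun x hx => Set.indicator_of_mem hx _)
  have hDF0 : ∫ x, D x * F x = 0 := by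
    rw [← hGind]
    refine tendsto_nhds_unique hlim ?_
    simp only [hzero]
    exact tendsto_const_nhds
  rw [hDF.2, sub_eq_zero] at hDF0
  exact hDF0

end Mopup

/-! ## The stub, in both strengths -/

/-- **Planar invariance from `L¹` regularity and generic invariance** — the `L¹` (function) form, i.e. the
generation-2 registered stub `stub_mopup : ∀ S₁, NPointRegular S₁ → GenericPlanarInvariant S₁ → PlanarInvariant S₁`
of `Cruxes/NPointIsotropy/Lines/complex-rotation-bandlimit.lean` with the line-local predicates `NPointRegular`,
`GenericPlanarInvariant`, `IsPlanarGeneric`, `planarRot` unfolded verbatim. If every `𝔖ₙ|⁰𝒮` is integration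
against a FUNCTION `Wₙ` (`Wₙ·F` integrable for `F ∈ ⁰𝒮ₙ`; no continuity) and `S₁` is invariant under the planar
rotations `planeRot 0 θ` on compactly supported off-diagonal test functions with planar-generic support, then `S₁` is
planar-invariant on all of `⁰𝒮`: every determinant-one isometry fixing `e₂, e₃` is a `planeRot 0 φ`
(`Mopup.exists_eq_planeRot`), the algebraic generic set of `Mopup.exists_generic_set` is open, conull, avoids the
coincidence locus and is planar-generic at every angle, and `Mopup.apply_linActMulti_eq_of_generic` concludes.
[folklore] -/
theorem planarInvariant_of_regular (S₁ : SchwingerFamily E4)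
    (hreg : ∀ n : ℕ, ∃ W : (Fin n → E4) → ℂ, ∀ F : 𝓢((Fin n → E4), ℂ), IsOffDiagonal F →
      MeasureTheory.Integrable (fun x : Fin n → E4 => W x * F x) ∧
        S₁ n F = ∫ x : Fin n → E4, W x * F x)
    (hgen : ∀ (θ : ℝ) (n : ℕ) (F : 𝓢((Fin n → E4), ℂ)), IsOffDiagonal F →
      HasCompactSupport (F : (Fin n → E4) → ℂ) →
      (∀ x ∈ tsupport (F : (Fin n → E4) → ℂ), ∀ θ : ℝ,
        (∀ i j : Fin n, i ≠ j → (planeRot (d := 3) 0 θ (x i)) 0 ≠ (planeRot (d := 3) 0 θ (x j)) 0) ∨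
        (∀ i j : Fin n, i ≠ j → (planeRot (d := 3) 0 θ (x i)) 1 ≠ (planeRot (d := 3) 0 θ (x j)) 1)) →
      S₁ n (linActMulti (planeRot (d := 3) 0 θ) F) = S₁ n F) :
    PlanarInvariant S₁ := by
  intro R hdet h2 h3 n F hF
  obtain ⟨φ, rfl⟩ := Mopup.exists_eq_planeRot R hdet h2 h3
  obtain ⟨W, hrep⟩ := hreg n
  obtain ⟨G, hGo, hG0, hGc, hGg⟩ := Mopup.exists_generic_set n
  refine Mopup.apply_linActMulti_eq_of_generic (S₁ n) hrep _ hGo hG0 hGc (fun F' hF'G hF'c => ?_) F hF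
  exact hgen φ n F' (IsOffDiagonal.of_tsupport_subset (hF'G.trans hGc)) hF'c
    fun x hx ψ => hGg x (hF'G hx) ψ

end Summit.QuantumFields.YangMills.Theorems.NPointIsotropy.ComplexRotationBandlimit

namespace Summit.QuantumFields.YangMills.Cruxes.CurvatureBoostCovariance.OneFieldCocyclePinning

open scoped BigOperators SchwartzMap InnerProductSpace ComplexConjugate
open MeasureTheory Filter Topology ClosedSubmodule
open Literature.MathematicalPhysics.QuantumLattice Literature.MathematicalPhysics.AQFT
  Literature.MathematicalPhysics.QuantumFieldTheory
open Summit.QuantumFields.YangMills.Theorems.NPointIsotropy.Negative (E4 RadialKernel radialKernel_invariant_two)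
open Summit.QuantumFields.YangMills.Theorems.CurvatureBoostCovariance.Negative
  (OSPackage Translations Hypercubic EightFrameRP PlanarCone PlanarInvariant Tie Gaps W1)

/-! ## §0 Vocabulary -/

/-- The right wedge `W_R = {x¹ > |x⁰|}` of Minkowski space `ℝ^{1+3}` (time = coordinate `0`). -/
def RightWedge : Set (SpaceTime 3) := {x | |x 0| < x 1}

/-- The left wedge `W_L = {x¹ < -|x⁰|}`, the causal complement of `W_R`. -/
def LeftWedge : Set (SpaceTime 3) := {x | |x 0| < -(x 1)}

/-- A real test function (`f̄ = f`). -/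
def IsRealTest (f : 𝓢(SpaceTime 3, ℂ)) : Prop := starTest f = f

/-- The wedge reflection `j : (x⁰,x¹,x²,x³) ↦ (-x⁰,-x¹,x²,x³)` (maps `W_R` onto `W_L`; in a
Bisognano–Wichmann theory `J_{W_R} φ(f)Ω = φ(f̄ ∘ j)Ω`). -/
def wedgeRefl : SpaceTime 3 ≃ₗᵢ[ℝ] SpaceTime 3 :=
  ((ℝ ∙ (EuclideanSpace.single 0 (1 : ℝ) : SpaceTime 3))ᗮ.reflection).trans
    ((ℝ ∙ (EuclideanSpace.single 1 (1 : ℝ) : SpaceTime 3))ᗮ.reflection)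

/-- `f ∘ j`. -/
def wedgeReflTest (f : 𝓢(SpaceTime 3, ℂ)) : 𝓢(SpaceTime 3, ℂ) :=
  SchwartzMap.compCLMOfContinuousLinearEquiv ℂ (wedgeRefl.toContinuousLinearEquiv : SpaceTime 3 ≃L[ℝ] SpaceTime 3) f

/-- `f ∘ Λ₁(χ)`, `Λ₁(χ)` the boost of rapidity `χ` in the `x¹`-direction (tree `boost 0 χ`). -/
def boostTest (χ : ℝ) (f : 𝓢(SpaceTime 3, ℂ)) : 𝓢(SpaceTime 3, ℂ) :=
  SchwartzMap.compCLMOfContinuousLinearEquiv ℂ (boost (0 : Fin 3) χ) f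

variable (W : WightmanData 3 Unit)

/-- The one-field vector `φ(f)Ω ∈ ℋ`. -/
def onePt (f : 𝓢(SpaceTime 3, ℂ)) : W.H := (W.field () f W.vacuumDom : W.H)

/-- The polynomial vector `φ(f₁)⋯φ(fₙ)Ω` of a list of test functions. -/
def polyVec (l : List (𝓢(SpaceTime 3, ℂ))) : W.H := (W.fieldMonomial (l.map fun f => ((), f)) W.vacuumDom : W.H)

/-- **Wightman axioms WITHOUT Lorentz covariance** for one hermitian scalar field on `ℝ^{1+3}`, with the PLANAR
spectral condition `H ≥ |P₁|` (all the `e₀`-reconstruction of a planar-coned Schwinger family can give) and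
WEDGE locality (fields smeared in `W_R` commute with fields smeared in `W_L` on the domain). -/
structure NoLorentzWightman : Prop where
  spectral : W.transl.HasFourierSpectrumIn {p : SpaceTime 3 | |p 1| ≤ p 0}
  uniqueVacuum : W.transl.HasUniqueVacuum W.vacuum
  norm_vacuum : ‖W.vacuum‖ = 1
  dense_dom : Dense (W.dom : Set W.H)
  transl_dom : ∀ (a : Multiplicative (SpaceTime 3)) (ψ : W.H), ψ ∈ W.dom → W.transl a ψ ∈ W.dom
  tempered : ∀ ψ χ : W.dom, Continuous fun f : 𝓢(SpaceTime 3, ℂ) => ⟪(χ : W.H), (W.field () f ψ : W.H)⟫_ℂ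
  hermitian : ∀ (f : 𝓢(SpaceTime 3, ℂ)) (ψ χ : W.dom),
    ⟪(χ : W.H), (W.field () f ψ : W.H)⟫_ℂ = conj ⟪(ψ : W.H), (W.field () (starTest f) χ : W.H)⟫_ℂ
  transl_covariant : ∀ (a : Multiplicative (SpaceTime 3)) (f : 𝓢(SpaceTime 3, ℂ)) (ψ : W.dom)
    (hψ : W.transl a ψ ∈ W.dom),
    W.transl a (W.field () f ψ : W.H) = (W.field () (poincareTest (SemidirectProduct.inl a) f) ⟨W.transl a ψ, hψ⟩ : W.H)
  wedgeLocality : ∀ (f g : 𝓢(SpaceTime 3, ℂ)) (ψ : W.dom),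
    tsupport (f : SpaceTime 3 → ℂ) ⊆ RightWedge → tsupport (g : SpaceTime 3 → ℂ) ⊆ LeftWedge →
      W.field () f (W.field () g ψ) = W.field () g (W.field () f ψ)
  cyclic : Dense ((Submodule.span ℂ (Set.range fun l : List (Unit × 𝓢(SpaceTime 3, ℂ)) =>
    (W.fieldMonomial l W.vacuumDom : W.H))) : Set W.H)

/-- **`S₁` is the Wick rotation of `W` in the TIME variables** (OS II §IV.2 form, no rotations: a function continuous on
the time tube, holomorphic in the complex times, of OS growth, whose time-ray boundary value is the `n`-point Wightman
distribution of `W` and whose Euclidean values give `𝔖ₙ` on time-ordered test functions). -/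
def IsTimeWickRotationOf (S₁ : SchwingerFamily E4) : Prop :=
  ∀ n : ℕ, ∃ (𝔚 : (Fin n → Fin 4 → ℂ) → ℂ) (T : 𝓢((Fin n → SpaceTime 3), ℂ) →L[ℂ] ℂ),
    ContinuousOn 𝔚 (timeTube 3 n) ∧ IsTimeHolomorphicOn 𝔚 (timeTube 3 n) ∧ HasOSGrowth 𝔚 ∧
    HasTimeRayBoundaryValue 𝔚 T ∧ IsWightmanDistributionOf W n (fun _ => ()) T ∧
    ∀ F : 𝓢((Fin n → E4), ℂ), IsTimeOrdered F →
      S₁ n F = ∫ x : Fin n → E4, 𝔚 (euclideanPoint x) * F x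

/-- The real span of the `S`-symmetrised wedge polynomial vectors `XΩ + X⁺Ω`, `i(XΩ − X⁺Ω)`, `X = φ(f₁)⋯φ(fₙ)`,
`fᵢ` real and supported in `W_R` (`X⁺ = φ(fₙ)⋯φ(f₁)`): the fixed points of the Tomita operator `XΩ ↦ X⁺Ω` of the wedge
polynomial algebra. Its closure is THE wedge standard subspace `K` of the line. -/
def realWedgeSpan : Submodule ℝ W.H :=
  Submodule.span ℝ {v : W.H | ∃ l : List (𝓢(SpaceTime 3, ℂ)),
    (∀ f ∈ l, IsRealTest f ∧ tsupport (f : SpaceTime 3 → ℂ) ⊆ RightWedge) ∧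
    (v = polyVec W l + polyVec W l.reverse ∨ v = Complex.I • (polyVec W l - polyVec W l.reverse))}

/-- `K` is the wedge standard subspace: the closure of `realWedgeSpan W` (its standardness — `K ∩ iK = 0`,
`K + iK` dense — is Reeh–Schlieder for both wedges plus wedge locality: the route's AxisWedgeStandardness). -/
def IsWedgeStandardSubspace (K : StandardSubspace W.H) : Prop :=
  ∀ x : W.H, x ∈ K.toClosedSubmodule ↔ x ∈ closure ((realWedgeSpan W : Submodule ℝ W.H) : Set W.H)

/-- The wedge von Neumann algebra `M` in standard form: `Ω` cyclic and separating for `M`, the wedge fields weakly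
affiliated with `M` (they commute with `M'` in the form sense on the domain), and `K` = the standard subspace
`closure {AΩ : A ∈ M, A = A*}` of `(M, Ω)` (so the modular data of `K` are those of `(M, Ω)`). -/
def WedgeAlgebraLink (K : StandardSubspace W.H) (M : VonNeumannAlgebra W.H) : Prop :=
  IsStandardVector M W.vacuum ∧
  (∀ A' : W.H →L[ℂ] W.H, A' ∈ M.commutant → ∀ f : 𝓢(SpaceTime 3, ℂ), IsRealTest f →
    tsupport (f : SpaceTime 3 → ℂ) ⊆ RightWedge → ∀ ψ χ : W.dom,
      ⟪(χ : W.H), A' (W.field () f ψ : W.H)⟫_ℂ = ⟪(W.field () f χ : W.H), A' (ψ : W.H)⟫_ℂ) ∧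
  (∀ x : W.H, x ∈ K.toClosedSubmodule ↔
    x ∈ closure {y : W.H | ∃ A : W.H →L[ℂ] W.H, A ∈ M ∧ IsSelfAdjoint A ∧ y = A W.vacuum})

variable {W}

/-- **(P_J) one-field pinning**: the modular conjugation of the wedge standard subspace acts on one-field wedge
vectors as the wedge reflection, WEAKLY against one-field wedge vectors:
`⟪φ(g)Ω, J_K φ(f)Ω⟫ = ⟪φ(g)Ω, φ(f ∘ j)Ω⟫ = 𝒲₂(g, f∘j)` for real `f, g` supported in `W_R`. -/
def JPinned (K : StandardSubspace W.H) (D : StandardSubspace.ModularData K) : Prop :=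
  ∀ f g : 𝓢(SpaceTime 3, ℂ), IsRealTest f → IsRealTest g →
    tsupport (f : SpaceTime 3 → ℂ) ⊆ RightWedge → tsupport (g : SpaceTime 3 → ℂ) ⊆ RightWedge →
      ⟪onePt W g, D.J (onePt W f)⟫_ℂ = ⟪onePt W g, onePt W (wedgeReflTest f)⟫_ℂ

/-- **One-field geometric modular action**: `Δ_K^{it}` acts on ALL one-field vectors as the boost of rapidity
`±2πt` (sign left open: it is immaterial downstream and depends only on conventions). -/
def OneFieldGeometric (K : StandardSubspace W.H) (D : StandardSubspace.ModularData K) : Prop :=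
  ∃ ε : ℝ, (ε = 1 ∨ ε = -1) ∧ ∀ (t : ℝ) (f : 𝓢(SpaceTime 3, ℂ)),
    D.U.appReal t (onePt W f) = onePt W (boostTest (ε * (2 * Real.pi * t)) f)

variable (W) in
/-- Invariance of every `n`-point Wightman function under the planar boosts `Λ₁(χ)`. -/
def BoostInvariantWightman : Prop :=
  ∀ (χ : ℝ) (n : ℕ) (f : Fin n → 𝓢(SpaceTime 3, ℂ)),
    W.wightmanFn n (fun _ => ()) (fun i => boostTest χ (f i)) = W.wightmanFn n (fun _ => ()) f

/-- Planar-rotation invariance of the TWO-point function on `⁰𝒮₂` (the output (S2) of the companion two-point lever;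
here delivered by `PencilRigidity.ShellRigidity ∘ KernelTransfer ∘ CurvatureKernelBound`). -/
def TwoPointPlanarInvariant (S₁ : SchwingerFamily E4) : Prop :=
  ∀ R : E4 ≃ₗᵢ[ℝ] E4, LinearMap.det (R.toLinearEquiv : E4 →ₗ[ℝ] E4) = 1 →
    R (EuclideanSpace.single 2 1) = EuclideanSpace.single 2 1 →
    R (EuclideanSpace.single 3 1) = EuclideanSpace.single 3 1 →
      ∀ F : 𝓢((Fin 2 → E4), ℂ), IsOffDiagonal F → S₁ 2 (linActMulti R F) = S₁ 2 F


/-! ## §1 The stubs (the only `sorry`s of this file) -/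

/-- **Stub A — `stub_tieRegularity` (Step 0; USES THE TIE; XL, a property of the Wilson limit).** For every compact
simple `G`, `(r, sch, S₁)` with the curvature package `W1 r sch S₁` (lattice tie at every order, OS package,
translations, proper hypercubic invariance, both gaps), the eight planar frames and the planar cone, every `𝔖ₙ|⁰𝒮` is a
FUNCTION (`L¹` against off-diagonal test functions).  The junk-killer demanded by the landed
`NPointIsotropy.Negative.ModelBlindFalse` / `TieLoadBearing` (transfer verbatim to this crux, triage r1-2 §G1):
every later stub argues in Hilbert space or on time-ordered supports and never sees the tie set `𝔈ₙ`; the mop-up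
to all of `⁰𝒮` (`planarInvariant_of_regular`, landed) needs exactly this.  Same statement as NPointIsotropy's
registered Step 0 with `PlanarCone` in place of `RadialKernel` (weakest form: all hypotheses of the crux). Certified
inhabitants of `W1` satisfy it (`c ≡ 0`: `Wₙ = 0`; `β_k = 0` frequently: c-number field; Disproof §2, §6). -/
theorem stub_tieRegularity :
    open Literature.MathematicalPhysics.QuantumLattice Literature.MathematicalPhysics.AQFT
      Literature.MathematicalPhysics.QuantumFieldTheory
      Summit.QuantumFields.YangMills.Theorems.CurvatureBoostCovariance.Negative
      Summit.QuantumFields.YangMills.Theorems.NPointIsotropy.Negative in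
    ∀ (G : Type) [Group G] [TopologicalSpace G] [IsTopologicalGroup G] [CompactSpace G]
      [MeasurableSpace G] [BorelSpace G], IsCompactSimpleLieGroup G →
      ∀ (r : LatticeRep G) (sch : SpeciesScheme (YMSpecies G)) (S₁ : SchwingerFamily E4),
        W1 r sch S₁ → EightFrameRP S₁ → PlanarCone S₁ →
        ∀ n : ℕ, ∃ W : (Fin n → E4) → ℂ, ∀ F : SchwartzMap (Fin n → E4) ℂ, IsOffDiagonal F →
          MeasureTheory.Integrable (fun x : Fin n → E4 => W x * F x) ∧
            S₁ n F = ∫ x : Fin n → E4, W x * F x := by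
  sorry

/-- **Stub C — `stub_wedgeReconstruction` (the REAL-TIME PACKAGE = the route's foreseen child AxisWedgeStandardness;
model-blind; XL).** A one-species family with the OS package (E0, E0', ordered E2, E3, E4), translations, proper
hypercubic invariance, a mass gap, E2 in the eight planar frames, the planar cone and the `L¹` regularity of every
`𝔖ₙ|⁰𝒮` is the time-Wick-rotation of Wightman data `W` WITHOUT Lorentz covariance (Osterwalder–Schrader 1973 §4.1
and 1975 §IV–VI with rotations nowhere used: `ℋ, Ω, e^{-tH}, U(a⃗)` from E2 + translations — tree
`OSReconstructionNoE1` —, fields and temperedness from E0', the multi-time continuation from E2 in the sixteen frames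
instead of Glaser's `SO(4)` step, the PLANAR spectral condition `H ≥ |P₁|` from the planar cone, uniqueness of the
vacuum from E4, WEDGE locality `[φ(f), φ(g)] = 0` (`f ⊂ W_R`, `g ⊂ W_L`) from E3 + slit analyticity across the
diagonal mirrors); the symmetrised real wedge polynomial vectors span a STANDARD subspace `K` (Reeh–Schlieder for
both wedges by planar-tube analyticity of translations; `K ∩ iK = 0` from closability of `XΩ ↦ X⁺Ω`, i.e. wedge
locality); and there is a wedge von Neumann algebra `M` in standard form with the wedge fields weakly affiliated and
`K` its standard subspace (Bisognano–Wichmann 1975 Lemma-type / Driessler–Summers–Wichmann 1986 regularity: the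
bounded-algebra content of wedge locality).  Why it might fail: multi-time analyticity and wedge locality without E1
are unproved (cf. NPointIsotropy `stub_entire` worker verdict); the `M`-part needs energy bounds. -/
theorem stub_wedgeReconstruction :
    open Literature.MathematicalPhysics.QuantumLattice Literature.MathematicalPhysics.AQFT
      Literature.MathematicalPhysics.QuantumFieldTheory
      Summit.QuantumFields.YangMills.Theorems.CurvatureBoostCovariance.Negative
      Summit.QuantumFields.YangMills.Theorems.NPointIsotropy.Negative in
    ∀ S₁ : SchwingerFamily E4, OSPackage S₁ → Translations S₁ → Hypercubic S₁ →
      (∃ Δ : ℝ, 0 < Δ ∧ S₁.toLabelled.HasMassGap Δ) → EightFrameRP S₁ → PlanarCone S₁ →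
      (∀ n : ℕ, ∃ W : (Fin n → E4) → ℂ, ∀ F : SchwartzMap (Fin n → E4) ℂ, IsOffDiagonal F →
        MeasureTheory.Integrable (fun x : Fin n → E4 => W x * F x) ∧
          S₁ n F = ∫ x : Fin n → E4, W x * F x) →
      ∃ (W : WightmanData 3 Unit) (K : StandardSubspace W.H) (M : VonNeumannAlgebra W.H),
        NoLorentzWightman W ∧ IsTimeWickRotationOf W S₁ ∧ IsWedgeStandardSubspace W K ∧
          WedgeAlgebraLink W K M := by
  sorry

/-- **Stub D — `stub_continuumPinning` (THE BET of the line; YM-specific, USES THE TIE; XL).** For the curvature channel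
of a Wilson limit (`W1 r sch S₁`, eight frames, planar cone) and EVERY real-time package `(W, K, M)` of `S₁` as in
stub C, the modular conjugation of the wedge standard subspace acts on ONE-FIELD wedge vectors as the wedge reflection,
weakly against one-field wedge vectors: `⟪φ(g)Ω, J_K φ(f)Ω⟫ = 𝒲₂(g, f∘j)` (`JPinned`, the card's (P_J); equivalently
`⟨ξ, Δ_K^{1/2}ξ⟩` is the geometric quantity, since `S_K ξ = ξ` on real wedge vectors).  Template: an EXACT identity
at every lattice spacing `k` for Wilson's theory on free boxes — the half-space modular conjugation of a state that
is reflection positive across `x₁ = 0` is (`x₁`-mirror)∘(conjugation), by its reflection-positive Schmidt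
decomposition (axis RP only; triage r1-3: attack (P_J) first) — so the claim is a CONVERGENCE statement for a matrix
element between one-point curvature vectors (tools: KMS-stability of limits, D'Antoni–Doplicher–Fredenhagen–Longo
continuity of modular objects, gap-induced quasi-locality of the half-space modular Hamiltonian).  Honours
`Disproof.curvatureBoostCovariance_false_without_hconv`: this is where the lattice tie is consumed a second time;
discriminating: FALSE for every anisotropic Laurent-profile GFF (outer-factor cocycle, triage App. A/§C), TRUE for the
free net.  Why it might fail: (P) is not a closed condition under subsequential limits (UVStabilityNonUniqueness
partly engaged); the lattice `Δ_k` is the ALL-species wedge operator, the continuum `K` is the curvature species'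
(card's residual: retarget at the all-species wedge if needed). -/
theorem stub_continuumPinning :
    open Literature.MathematicalPhysics.QuantumLattice Literature.MathematicalPhysics.AQFT
      Literature.MathematicalPhysics.QuantumFieldTheory
      Summit.QuantumFields.YangMills.Theorems.CurvatureBoostCovariance.Negative
      Summit.QuantumFields.YangMills.Theorems.NPointIsotropy.Negative in
    ∀ (G : Type) [Group G] [TopologicalSpace G] [IsTopologicalGroup G] [CompactSpace G]
      [MeasurableSpace G] [BorelSpace G], IsCompactSimpleLieGroup G →
      ∀ (r : LatticeRep G) (sch : SpeciesScheme (YMSpecies G)) (S₁ : SchwingerFamily E4),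
        W1 r sch S₁ → EightFrameRP S₁ → PlanarCone S₁ →
        ∀ (W : WightmanData 3 Unit) (K : StandardSubspace W.H) (M : VonNeumannAlgebra W.H)
          (D : StandardSubspace.ModularData K),
          NoLorentzWightman W → IsTimeWickRotationOf W S₁ → IsWedgeStandardSubspace W K →
          WedgeAlgebraLink W K M → JPinned K D := by
  sorry

/-- **Stub E — `stub_oneFieldRigidity` (the card's LEVER; model-blind functional analysis + two-point analysis; L).**
In any real-time package `(W, K)` of a family `S₁` whose two-point function is planar-rotation invariant on `⁰𝒮₂`
((S2) — the indispensable partner), one-field pinning (P_J) forces `Δ_K^{it}` to act GEOMETRICALLY (as boosts) on all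
one-field vectors.  Proof line: (S2) + planar spectral condition ⇒ `𝒲₂` boost invariant (analytic continuation in
the rotation angle, `n = 2`) ⇒ the geometric boosts `V` are unitary on `ℋ₁ = closure {φ(f)Ω}`; the one-field real
wedge space `K₁ ⊆ K` is standard in `ℋ₁′ = closure (K₁ + iK₁)` and `(V, J_geo)` are its modular data — one-field
Bisognano–Wichmann by the two-point Unruh/KMS computation (planar-tube analyticity, wedge locality) and KMS
uniqueness (tree `StandardSubspace.subsingleton_modularData_holds`, Rieffel–van Daele); then `Δ_K^{1/2}ξ = J_K S_K ξ =
J_K ξ` on `K₁`, pinning + `‖Δ_K^{1/2}ζ‖ = ‖S ζ‖ = ‖Δ₁^{1/2}ζ‖` give `Δ_K^{1/2} ⊇ Δ₁^{1/2}` on `K₁ + iK₁ = D(Δ₁^{1/2})`,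
and a self-adjoint operator extending a self-adjoint operator on a closed subspace is reduced by it (3-line
reduction lemma, triage r1-2/3): `Δ_K^{it}|ℋ₁′ = Δ₁^{it} = V(∓2πt)`.  First-lemma material already checked by the
panel: `CompressionSqrtRigidity`, `CovariantKMSUniqueness`, `periodic_zeroFree_rigidity` (SketchIdeator2.lean).
Not a costume: the conclusion concerns ONE-field vectors only, and both hypotheses are load-bearing — (S2) by
the card's free-net example (an anisotropic derivative species `e₂(∂²)φ` of the isotropic free net: the NET's wedge
conjugation is geometric on its one-field vectors, the species is anisotropic), (P_J) because with (S2) alone the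
conclusion is species-Bisognano–Wichmann on `ℋ₁`, for which no model-blind mechanism exists (GaierYngvason2000;
the anisotropic Laurent-profile GFFs show `J_K|ℋ₁` CAN be the non-geometric outer-factor conjugation). -/
theorem stub_oneFieldRigidity :
    open Literature.MathematicalPhysics.QuantumLattice Literature.MathematicalPhysics.AQFT
      Literature.MathematicalPhysics.QuantumFieldTheory
      Summit.QuantumFields.YangMills.Theorems.NPointIsotropy.Negative in
    ∀ (S₁ : SchwingerFamily E4) (W : WightmanData 3 Unit) (K : StandardSubspace W.H)
      (D : StandardSubspace.ModularData K),
      NoLorentzWightman W → IsTimeWickRotationOf W S₁ → IsWedgeStandardSubspace W K →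
      TwoPointPlanarInvariant S₁ → JPinned K D → OneFieldGeometric K D := by
  sorry

/-- **Stub F — `stub_separatingLift` (one field ⇒ all fields; algebraic QFT; L).** If `Δ_K^{it}` acts as boosts on
one-field vectors, it acts as boosts on all polynomial vectors, hence every Wightman function is boost invariant:
`Ad Δ_K^{it}` preserves the wedge algebra `M` (Tomita–Takesaki), `A := Δ^{it}φ(f)Δ^{-it}` and `B := φ(f∘Λ)` are
affiliated with `M` and agree on `Ω`, `Ω` is separating for `M` (cyclic for `M'`), so `A = B` weakly on `M'Ω`;
induct on the number of fields (`Δ^{it}Ω = Ω`), then remove the wedge-support restriction by translation covariance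
and analyticity.  The domain technicalities of unbounded fields (closures, cores) are the prover's; the weak
affiliation and standard form are hypotheses (`WedgeAlgebraLink`, from stub C).  Triage r1-1 asked for exactly this
stub ("needs Ω separating for the wedge polynomial algebra plus a core/affiliation argument; state it as a stub"). -/
theorem stub_separatingLift :
    ∀ (W : WightmanData 3 Unit) (K : StandardSubspace W.H) (M : VonNeumannAlgebra W.H)
      (D : StandardSubspace.ModularData K),
      NoLorentzWightman W → IsWedgeStandardSubspace W K → WedgeAlgebraLink W K M →
      OneFieldGeometric K D → BoostInvariantWightman W := by
  sorry

/-- **Stub G — `stub_euclideanReturn` (Osterwalder–Schrader §4.2 BACKWARDS; complex analysis; L).** Boost-invariant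
Wightman distributions of a time-Wick-rotation `W` of `S₁` (planar spectral condition) make `S₁` planar-rotation
invariant on planar-GENERIC compact supports: the planar spectral condition continues `𝔚ₙ` to the planar tube
`{|Im z¹-differences| < Im z⁰-differences, z², z³ real}` (Fourier–Laplace, as the tree's
`exists_tubeFunction_of_fourierSupportedIn_spectralSet` for the round cone), uniqueness of time-ray boundary values
(`eqOn_timeTube_of_timeRayBoundaryValue`) identifies it with `𝔚ₙ` at Euclidean points, real boosts preserve the planar
tube and fix the boundary value, so `w ↦ 𝔚ₙ(Λ₁(w) z)` is constant on the connected component of `ℝ` — which contains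
`iθ` as long as the rotated Euclidean configuration stays time-ordered (`Λ₁(iθ)` = rotation by `θ` of the
`(x₀,x₁)`-plane at Euclidean points, tree `boostC_mul_I_euclideanPoint`); time-ordered pieces of a distinct-times
support are re-sorted by E3, equal-`x₀` angles are handled by the hypercubic quarter-turn (then the `x₁` are
distinct), and `θ ↦ 𝔖ₙ(R_θ·F)` is locally constant on `ℝ`.  The conclusion is the `GenericPlanarInvariant` input of
the landed mop-up `planarInvariant_of_regular` (unfolded verbatim). -/
theorem stub_euclideanReturn :
    open Literature.MathematicalPhysics.QuantumLattice Literature.MathematicalPhysics.AQFT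
      Literature.MathematicalPhysics.QuantumFieldTheory
      Summit.QuantumFields.YangMills.Theorems.CurvatureBoostCovariance.Negative
      Summit.QuantumFields.YangMills.Theorems.NPointIsotropy.Negative in
    ∀ (S₁ : SchwingerFamily E4) (W : WightmanData 3 Unit), OSPackage S₁ → Translations S₁ → Hypercubic S₁ →
      NoLorentzWightman W → IsTimeWickRotationOf W S₁ → BoostInvariantWightman W →
      ∀ (θ : ℝ) (n : ℕ) (F : SchwartzMap (Fin n → E4) ℂ), IsOffDiagonal F →
        HasCompactSupport (F : (Fin n → E4) → ℂ) →
        (∀ x ∈ tsupport (F : (Fin n → E4) → ℂ), ∀ φ : ℝ,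
          (∀ i j : Fin n, i ≠ j → (planeRot (d := 3) 0 φ (x i)) 0 ≠ (planeRot (d := 3) 0 φ (x j)) 0) ∨
          (∀ i j : Fin n, i ≠ j → (planeRot (d := 3) 0 φ (x i)) 1 ≠ (planeRot (d := 3) 0 φ (x j)) 1)) →
        S₁ n (linActMulti (planeRot (d := 3) 0 θ) F) = S₁ n F := by
  sorry

/-! ## §2 Checks against landed knowledge (imports live; sorry-free) -/

/-- (S2) at the level the lever consumes it: the radial kernel delivered by `PencilRigidity.CurvatureKernelBound →
KernelTransfer → ShellRigidity` gives planar (indeed full) invariance of `S₁ 2` on `⁰𝒮₂` (landed `DegreeTwoFree`). -/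
theorem twoPointPlanarInvariant_of_radialKernel {S₁ : SchwingerFamily E4} (hK : RadialKernel S₁) :
    TwoPointPlanarInvariant S₁ :=
  fun R _ _ _ F hF => radialKernel_invariant_two hK R F hF

/-! ## §3 Composition (kernel-checked, sorry-free): the stubs prove the crux BY NAME -/

/-- **`CurvatureBoostCovariance` from the six stubs**, with the two-point front end taken BY NAME from route
PencilRigidity (items `CurvatureKernelBound` stmt-11687 — the one UV datum, YM-specific —, `KernelTransfer` stmt-11688,
`ShellRigidity` stmt-11685; one proof serves both routes, triage r1-2 §G2).  Logic: tie ⇒ regularity (A); the three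
PencilRigidity items ⇒ radial two-point kernel ⇒ (S2); real-time package (C); continuum pinning in it (D); one-field
rigidity (E); separating lift (F); Euclidean return (G); landed mop-up `planarInvariant_of_regular`. -/
theorem CurvatureBoostCovariance_of
    (hCKB : Summit.QuantumFields.YangMills.Theses.PencilRigidity.CurvatureKernelBound)
    (hKT : Summit.QuantumFields.YangMills.Theses.PencilRigidity.KernelTransfer)
    (hSR : Summit.QuantumFields.YangMills.Theses.PencilRigidity.ShellRigidity) :
    Summit.QuantumFields.YangMills.Theses.MirrorModularBoosts.CurvatureBoostCovariance := by
  rw [Summit.QuantumFields.YangMills.Theorems.CurvatureBoostCovariance.Negative.crux_iff]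
  intro G _ _ _ _ hG r sch S₁ hW h8 hC
  letI : MeasurableSpace G := borel G
  haveI : BorelSpace G := ⟨rfl⟩
  -- Step 0: the tie ⇒ every `𝔖ₙ|⁰𝒮` is a function
  have hreg := stub_tieRegularity G hG r sch S₁ hW h8 hC
  -- (S2): the PencilRigidity front end ⇒ radial two-point kernel ⇒ planar invariance of `S₁ 2`
  obtain ⟨K, C, η, hη, hKc, hKb, hKr⟩ := hCKB G hG r sch S₁ hW
  obtain ⟨htie, hOS, htr, hhyp, hgaps⟩ := hW
  obtain ⟨hinv, hpos0, hpos1⟩ := hKT S₁ K hKc hKr hOS.2.2.2.2.1 hhyp h8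
  have hrad : ∀ (R : E4 ≃ₗᵢ[ℝ] E4) (x : E4), x ≠ 0 → K (R x) = K x := hSR K hKc ⟨C, η, hη, hKb⟩ hinv hpos0 hpos1
  have h2 : TwoPointPlanarInvariant S₁ := twoPointPlanarInvariant_of_radialKernel ⟨K, hKc, hrad, hKr⟩
  have hgap : ∃ Δ : ℝ, 0 < Δ ∧ S₁.toLabelled.HasMassGap Δ := hgaps.imp fun Δ hΔ => ⟨hΔ.1, hΔ.2.1⟩
  -- the real-time package and the modular engine
  obtain ⟨W, K', M, hNL, hWick, hKstd, hM⟩ := stub_wedgeReconstruction S₁ hOS htr hhyp hgap h8 hC hreg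
  obtain ⟨D⟩ := StandardSubspace.exists_modularData_holds W.H K'
  have hpin : JPinned K' D :=
    stub_continuumPinning G hG r sch S₁ ⟨htie, hOS, htr, hhyp, hgaps⟩ h8 hC W K' M D hNL hWick hKstd hM
  have hgeo : OneFieldGeometric K' D := stub_oneFieldRigidity S₁ W K' D hNL hWick hKstd h2 hpin
  have hboost : BoostInvariantWightman W := stub_separatingLift W K' M D hNL hKstd hM hgeo
  have hgen := stub_euclideanReturn S₁ W hOS htr hhyp hNL hWick hboost
  -- mop-up to all of `⁰𝒮` (landed, sorry-free)
  exact Summit.QuantumFields.YangMills.Theorems.NPointIsotropy.ComplexRotationBandlimit.planarInvariant_of_regular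
    S₁ hreg hgen

end Summit.QuantumFields.YangMills.Cruxes.CurvatureBoostCovariance.OneFieldCocyclePinning

end
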